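import Mathlib
import HarnessLib
import HarnessLib.Audit
import Summits.Langlands.Statement
import Summits.Langlands.Langlands.Theses.PrimeSwitchSplit
import Summits.Langlands.Langlands.Theses.NonParallelVoid
import Literature.NumberTheory.GaloisRepresentations.LabelledHodgeTateWeights
import Literature.NumberTheory.PAdicHodge.FontaineDpst
import Summits.Langlands.Langlands.Theses.HodgeTatePurityCarving

/-! # BC3 birth skeleton (pre-birth twin: verbatim copies of the cell and stub statements; `Iff.rfl` to the route decl once born) for
`HodgeTatePurityCarving.ImpureWeightAutomorphy` (IMPB).  NAMED stubs: `stub_impureRegular` (REGULAR labelled weights) and `stub_impureIrregular` (IRREGULAR), an exact split one level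
down; `ImpureWeightAutomorphy_of` is the composition by cases on regularity (kernel-checked, sorries ONLY inside `stub_*`).  The BC5 rung `stub_rung_impureRankOne` (n = 1, PRINT)
is a PLAN-ONLY named stub NOT consumed by `ImpureWeightAutomorphy_of`. -/

set_option linter.dupNamespace false
set_option linter.unusedVariables false

namespace Summit.Langlands.Langlands.Theses.HodgeTatePurityCarving.Birth.ImpureWeightAutomorphy

open scoped BigOperators Topology Manifold Classical MeasureTheory ProbabilityTheory Matrix InnerProductSpace ComplexConjugate ContinuousMap
open Filter Set Function TopologicalSpace MeasureTheory

/-- verbatim copy of the cell `ImpureWeightAutomorphy` (texts.json; = the route decl by `Iff.rfl` after birth). -/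
def ImpureWeightAutomorphy : Prop :=
  ∀ (K : Type) [Field K] [NumberField K] (n : ℕ) (hcpt : Literature.NumberTheory.Automorphic.isCompact_glFiniteIntegralLevel n K), 0 < n → ∀ (ℓ : ℕ) [Fact ℓ.Prime] (ι : PadicAlgCl ℓ ≃+* ℂ) (ρ : Literature.NumberTheory.GaloisRepresentations.FramedGaloisRep K (PadicAlgCl ℓ) n), ρ.toGaloisRep.IsIrreducible → ¬ (∃ w : ℤ, ∀ (v₁ : IsDedekindDomain.HeightOneSpectrum (NumberField.RingOfIntegers K)) (hv₁ : ((ℓ : ℕ) : NumberField.RingOfIntegers K) ∈ v₁.asIdeal) (v₂ : IsDedekindDomain.HeightOneSpectrum (NumberField.RingOfIntegers K)) (hv₂ : ((ℓ : ℕ) : NumberField.RingOfIntegers K) ∈ v₂.asIdeal), letI := (Literature.NumberTheory.PAdicHodge.fontainePstAdicCompletion v₁ ℓ hv₁).algebra; letI := (Literature.NumberTheory.PAdicHodge.fontainePstAdicCompletion v₂ ℓ hv₂).algebra; ∀ (τ₁ : v₁.adicCompletion K →ₐ[ℚ_[ℓ]] PadicAlgCl ℓ) (τ₂ : v₂.adicCompletion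 K →ₐ[ℚ_[ℓ]] PadicAlgCl ℓ), (∀ x : K, ι (τ₂ (algebraMap K (v₂.adicCompletion K) x)) = starRingEnd ℂ (ι (τ₁ (algebraMap K (v₁.adicCompletion K) x)))) → ρ.labelledHodgeTateWeightsAt v₂ (Literature.NumberTheory.PAdicHodge.fontainePstAdicCompletion v₂ ℓ hv₂).algebra (Literature.NumberTheory.PAdicHodge.fontainePstAdicCompletion v₂ ℓ hv₂).𝔅 τ₂.toRingHom = Multiset.map (fun k : ℤ => w - k) (ρ.labelledHodgeTateWeightsAt v₁ (Literature.NumberTheory.PAdicHodge.fontainePstAdicCompletion v₁ ℓ hv₁).algebra (Literature.NumberTheory.PAdicHodge.fontainePstAdicCompletion v₁ ℓ hv₁).𝔅 τ₁.toRingHom)) → ((∀ᶠ v : IsDedekindDomain.HeightOneSpectrum (NumberField.RingOfIntegers K) in cofinite, ρ.IsUnramifiedAt v) ∧ ∀ (v : IsDedekindDomain.HeightOneSpectrum (NumberField.RingOfIntegers K)) (hv : ((ℓ : ℕ) : NumberField.RingOfIntegers K) ∈ v.asIdeal), (Literature.NumberTheory.PAdicHodge.fontainePstAdicCompletion v ℓ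 hv).IsDeRhamFramed (ρ.toLocal v)) → ∃ π : Literature.NumberTheory.Automorphic.CuspidalAutomorphicRepData n K hcpt, π.1.IsLAlgebraic ∧ ∀ᶠ v : IsDedekindDomain.HeightOneSpectrum (NumberField.RingOfIntegers K) in cofinite, SatakeFrobCompatibleAt ι π.1 ρ v

/-- stub IMPB∣REGULAR — weak automorphy of irreducible geometric ι-IMPURE ρ with REGULAR labelled weights. Conjecturally VACUOUS (such ρ do not exist: Buzzard–Gee Conj. 3.2.2/Rem. 3.2.3 + Clozel purity); the regular case is where Galois-deformation arguments in EMPTY cohomological weight can bite (Calegari 2011 Thm 1.3 for GL₂ over imaginary quadratic fields, ordinary big image; the dormant route NonParallelVoid for n = 2 IQ — linked by the node's kernel theorem impureRankTwoIQ_of_void). OPEN core: n ≥ 3 / non-CM K / non-ordinary. -/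
theorem stub_impureRegular :
    ∀ (K : Type) [Field K] [NumberField K] (n : ℕ) (hcpt : Literature.NumberTheory.Automorphic.isCompact_glFiniteIntegralLevel n K), 0 < n → ∀ (ℓ : ℕ) [Fact ℓ.Prime] (ι : PadicAlgCl ℓ ≃+* ℂ) (ρ : Literature.NumberTheory.GaloisRepresentations.FramedGaloisRep K (PadicAlgCl ℓ) n), ρ.toGaloisRep.IsIrreducible → ¬ (∃ w : ℤ, ∀ (v₁ : IsDedekindDomain.HeightOneSpectrum (NumberField.RingOfIntegers K)) (hv₁ : ((ℓ : ℕ) : NumberField.RingOfIntegers K) ∈ v₁.asIdeal) (v₂ : IsDedekindDomain.HeightOneSpectrum (NumberField.RingOfIntegers K)) (hv₂ : ((ℓ : ℕ) : NumberField.RingOfIntegers K) ∈ v₂.asIdeal), letI := (Literature.NumberTheory.PAdicHodge.fontainePstAdicCompletion v₁ ℓ hv₁).algebra; letI := (Literature.NumberTheory.PAdicHodge.fontainePstAdicCompletion v₂ ℓ hv₂).algebra; ∀ (τ₁ : v₁.adicCompletion K →ₐ[ℚ_[ℓ]] PadicAlgCl ℓ) (τ₂ : v₂.adicCompletion K →ₐ[ℚ_[ℓ]]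 PadicAlgCl ℓ), (∀ x : K, ι (τ₂ (algebraMap K (v₂.adicCompletion K) x)) = starRingEnd ℂ (ι (τ₁ (algebraMap K (v₁.adicCompletion K) x)))) → ρ.labelledHodgeTateWeightsAt v₂ (Literature.NumberTheory.PAdicHodge.fontainePstAdicCompletion v₂ ℓ hv₂).algebra (Literature.NumberTheory.PAdicHodge.fontainePstAdicCompletion v₂ ℓ hv₂).𝔅 τ₂.toRingHom = Multiset.map (fun k : ℤ => w - k) (ρ.labelledHodgeTateWeightsAt v₁ (Literature.NumberTheory.PAdicHodge.fontainePstAdicCompletion v₁ ℓ hv₁).algebra (Literature.NumberTheory.PAdicHodge.fontainePstAdicCompletion v₁ ℓ hv₁).𝔅 τ₁.toRingHom)) → (∀ (v : IsDedekindDomain.HeightOneSpectrum (NumberField.RingOfIntegers K)) (hv : ((ℓ : ℕ) : NumberField.RingOfIntegers K) ∈ v.asIdeal), letI := (Literature.NumberTheory.PAdicHodge.fontainePstAdicCompletion v ℓ hv).algebra; ∀ τ : v.adicCompletion K →ₐ[ℚ_[ℓ]] PadicAlgCl ℓ, (ρ.labelledHodgeTateWeightsAt v (Literature.NumberTheory.PAdicHodge.fontainePstAdicCompletion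 v ℓ hv).algebra (Literature.NumberTheory.PAdicHodge.fontainePstAdicCompletion v ℓ hv).𝔅 τ.toRingHom).Nodup) → ((∀ᶠ v : IsDedekindDomain.HeightOneSpectrum (NumberField.RingOfIntegers K) in cofinite, ρ.IsUnramifiedAt v) ∧ ∀ (v : IsDedekindDomain.HeightOneSpectrum (NumberField.RingOfIntegers K)) (hv : ((ℓ : ℕ) : NumberField.RingOfIntegers K) ∈ v.asIdeal), (Literature.NumberTheory.PAdicHodge.fontainePstAdicCompletion v ℓ hv).IsDeRhamFramed (ρ.toLocal v)) → ∃ π : Literature.NumberTheory.Automorphic.CuspidalAutomorphicRepData n K hcpt, π.1.IsLAlgebraic ∧ ∀ᶠ v : IsDedekindDomain.HeightOneSpectrum (NumberField.RingOfIntegers K) in cofinite, SatakeFrobCompatibleAt ι π.1 ρ v := by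
  sorry

/-- stub IMPB∣IRREGULAR — impure ρ with a repeated labelled weight: no engine at all (IDEA-NEEDED: a Galois-side purity theorem for de Rham representations, known only for n = 1 and for ρ from pure motives with a polarisation). -/
theorem stub_impureIrregular :
    ∀ (K : Type) [Field K] [NumberField K] (n : ℕ) (hcpt : Literature.NumberTheory.Automorphic.isCompact_glFiniteIntegralLevel n K), 0 < n → ∀ (ℓ : ℕ) [Fact ℓ.Prime] (ι : PadicAlgCl ℓ ≃+* ℂ) (ρ : Literature.NumberTheory.GaloisRepresentations.FramedGaloisRep K (PadicAlgCl ℓ) n), ρ.toGaloisRep.IsIrreducible → ¬ (∃ w : ℤ, ∀ (v₁ : IsDedekindDomain.HeightOneSpectrum (NumberField.RingOfIntegers K)) (hv₁ : ((ℓ : ℕ) : NumberField.RingOfIntegers K) ∈ v₁.asIdeal) (v₂ : IsDedekindDomain.HeightOneSpectrum (NumberField.RingOfIntegers K)) (hv₂ : ((ℓ : ℕ) : NumberField.RingOfIntegers K) ∈ v₂.asIdeal), letI := (Literature.NumberTheory.PAdicHodge.fontainePstAdicCompletion v₁ ℓ hv₁).algebra; letI := (Literature.NumberTheory.PAdicHodge.fontainePstAdicCompletion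 v₂ ℓ hv₂).algebra; ∀ (τ₁ : v₁.adicCompletion K →ₐ[ℚ_[ℓ]] PadicAlgCl ℓ) (τ₂ : v₂.adicCompletion K →ₐ[ℚ_[ℓ]] PadicAlgCl ℓ), (∀ x : K, ι (τ₂ (algebraMap K (v₂.adicCompletion K) x)) = starRingEnd ℂ (ι (τ₁ (algebraMap K (v₁.adicCompletion K) x)))) → ρ.labelledHodgeTateWeightsAt v₂ (Literature.NumberTheory.PAdicHodge.fontainePstAdicCompletion v₂ ℓ hv₂).algebra (Literature.NumberTheory.PAdicHodge.fontainePstAdicCompletion v₂ ℓ hv₂).𝔅 τ₂.toRingHom = Multiset.map (fun k : ℤ => w - k) (ρ.labelledHodgeTateWeightsAt v₁ (Literature.NumberTheory.PAdicHodge.fontainePstAdicCompletion v₁ ℓ hv₁).algebra (Literature.NumberTheory.PAdicHodge.fontainePstAdicCompletion v₁ ℓ hv₁).𝔅 τ₁.toRingHom)) → ¬ (∀ (v : IsDedekindDomain.HeightOneSpectrum (NumberField.RingOfIntegers K)) (hv : ((ℓ : ℕ) : NumberField.RingOfIntegers K) ∈ v.asIdeal), letI := (Literature.NumberTheory.PAdicHodge.fontainePstAdicCompletion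 v ℓ hv).algebra; ∀ τ : v.adicCompletion K →ₐ[ℚ_[ℓ]] PadicAlgCl ℓ, (ρ.labelledHodgeTateWeightsAt v (Literature.NumberTheory.PAdicHodge.fontainePstAdicCompletion v ℓ hv).algebra (Literature.NumberTheory.PAdicHodge.fontainePstAdicCompletion v ℓ hv).𝔅 τ.toRingHom).Nodup) → ((∀ᶠ v : IsDedekindDomain.HeightOneSpectrum (NumberField.RingOfIntegers K) in cofinite, ρ.IsUnramifiedAt v) ∧ ∀ (v : IsDedekindDomain.HeightOneSpectrum (NumberField.RingOfIntegers K)) (hv : ((ℓ : ℕ) : NumberField.RingOfIntegers K) ∈ v.asIdeal), (Literature.NumberTheory.PAdicHodge.fontainePstAdicCompletion v ℓ hv).IsDeRhamFramed (ρ.toLocal v)) → ∃ π : Literature.NumberTheory.Automorphic.CuspidalAutomorphicRepData n K hcpt, π.1.IsLAlgebraic ∧ ∀ᶠ v : IsDedekindDomain.HeightOneSpectrum (NumberField.RingOfIntegers K) in cofinite, SatakeFrobCompatibleAt ι π.1 ρ v := by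
  sorry

/-- `ImpureWeightAutomorphy` from its two stubs (kernel-checked, no sorry): cases on regularity of the labelled weights. -/
theorem ImpureWeightAutomorphy_of
    (hR : ∀ (K : Type) [Field K] [NumberField K] (n : ℕ) (hcpt : Literature.NumberTheory.Automorphic.isCompact_glFiniteIntegralLevel n K), 0 < n → ∀ (ℓ : ℕ) [Fact ℓ.Prime] (ι : PadicAlgCl ℓ ≃+* ℂ) (ρ : Literature.NumberTheory.GaloisRepresentations.FramedGaloisRep K (PadicAlgCl ℓ) n), ρ.toGaloisRep.IsIrreducible → ¬ (∃ w : ℤ, ∀ (v₁ : IsDedekindDomain.HeightOneSpectrum (NumberField.RingOfIntegers K)) (hv₁ : ((ℓ : ℕ) : NumberField.RingOfIntegers K) ∈ v₁.asIdeal) (v₂ : IsDedekindDomain.HeightOneSpectrum (NumberField.RingOfIntegers K)) (hv₂ : ((ℓ : ℕ) : NumberField.RingOfIntegers K) ∈ v₂.asIdeal), letI := (Literature.NumberTheory.PAdicHodge.fontainePstAdicCompletion v₁ ℓ hv₁).algebra; letI := (Literature.NumberTheory.PAdicHodge.fontainePstAdicCompletion v₂ ℓ hv₂).algebra; ∀ (τ₁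 : v₁.adicCompletion K →ₐ[ℚ_[ℓ]] PadicAlgCl ℓ) (τ₂ : v₂.adicCompletion K →ₐ[ℚ_[ℓ]] PadicAlgCl ℓ), (∀ x : K, ι (τ₂ (algebraMap K (v₂.adicCompletion K) x)) = starRingEnd ℂ (ι (τ₁ (algebraMap K (v₁.adicCompletion K) x)))) → ρ.labelledHodgeTateWeightsAt v₂ (Literature.NumberTheory.PAdicHodge.fontainePstAdicCompletion v₂ ℓ hv₂).algebra (Literature.NumberTheory.PAdicHodge.fontainePstAdicCompletion v₂ ℓ hv₂).𝔅 τ₂.toRingHom = Multiset.map (fun k : ℤ => w - k) (ρ.labelledHodgeTateWeightsAt v₁ (Literature.NumberTheory.PAdicHodge.fontainePstAdicCompletion v₁ ℓ hv₁).algebra (Literature.NumberTheory.PAdicHodge.fontainePstAdicCompletion v₁ ℓ hv₁).𝔅 τ₁.toRingHom)) → (∀ (v : IsDedekindDomain.HeightOneSpectrum (NumberField.RingOfIntegers K)) (hv : ((ℓ : ℕ) : NumberField.RingOfIntegers K) ∈ v.asIdeal), letI := (Literature.NumberTheory.PAdicHodge.fontainePstAdicCompletion v ℓ hv).algebra; ∀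 τ : v.adicCompletion K →ₐ[ℚ_[ℓ]] PadicAlgCl ℓ, (ρ.labelledHodgeTateWeightsAt v (Literature.NumberTheory.PAdicHodge.fontainePstAdicCompletion v ℓ hv).algebra (Literature.NumberTheory.PAdicHodge.fontainePstAdicCompletion v ℓ hv).𝔅 τ.toRingHom).Nodup) → ((∀ᶠ v : IsDedekindDomain.HeightOneSpectrum (NumberField.RingOfIntegers K) in cofinite, ρ.IsUnramifiedAt v) ∧ ∀ (v : IsDedekindDomain.HeightOneSpectrum (NumberField.RingOfIntegers K)) (hv : ((ℓ : ℕ) : NumberField.RingOfIntegers K) ∈ v.asIdeal), (Literature.NumberTheory.PAdicHodge.fontainePstAdicCompletion v ℓ hv).IsDeRhamFramed (ρ.toLocal v)) → ∃ π : Literature.NumberTheory.Automorphic.CuspidalAutomorphicRepData n K hcpt, π.1.IsLAlgebraic ∧ ∀ᶠ v : IsDedekindDomain.HeightOneSpectrum (NumberField.RingOfIntegers K) in cofinite, SatakeFrobCompatibleAt ι π.1 ρ v)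
    (hIR : ∀ (K : Type) [Field K] [NumberField K] (n : ℕ) (hcpt : Literature.NumberTheory.Automorphic.isCompact_glFiniteIntegralLevel n K), 0 < n → ∀ (ℓ : ℕ) [Fact ℓ.Prime] (ι : PadicAlgCl ℓ ≃+* ℂ) (ρ : Literature.NumberTheory.GaloisRepresentations.FramedGaloisRep K (PadicAlgCl ℓ) n), ρ.toGaloisRep.IsIrreducible → ¬ (∃ w : ℤ, ∀ (v₁ : IsDedekindDomain.HeightOneSpectrum (NumberField.RingOfIntegers K)) (hv₁ : ((ℓ : ℕ) : NumberField.RingOfIntegers K) ∈ v₁.asIdeal) (v₂ : IsDedekindDomain.HeightOneSpectrum (NumberField.RingOfIntegers K)) (hv₂ : ((ℓ : ℕ) : NumberField.RingOfIntegers K) ∈ v₂.asIdeal), letI := (Literature.NumberTheory.PAdicHodge.fontainePstAdicCompletion v₁ ℓ hv₁).algebra; letI := (Literature.NumberTheory.PAdicHodge.fontainePstAdicCompletion v₂ ℓ hv₂).algebra; ∀ (τ₁ : v₁.adicCompletion K →ₐ[ℚ_[ℓ]] PadicAlgCl ℓ) (τ₂ : v₂.adicCompletion K →ₐ[ℚ_[ℓ]]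 PadicAlgCl ℓ), (∀ x : K, ι (τ₂ (algebraMap K (v₂.adicCompletion K) x)) = starRingEnd ℂ (ι (τ₁ (algebraMap K (v₁.adicCompletion K) x)))) → ρ.labelledHodgeTateWeightsAt v₂ (Literature.NumberTheory.PAdicHodge.fontainePstAdicCompletion v₂ ℓ hv₂).algebra (Literature.NumberTheory.PAdicHodge.fontainePstAdicCompletion v₂ ℓ hv₂).𝔅 τ₂.toRingHom = Multiset.map (fun k : ℤ => w - k) (ρ.labelledHodgeTateWeightsAt v₁ (Literature.NumberTheory.PAdicHodge.fontainePstAdicCompletion v₁ ℓ hv₁).algebra (Literature.NumberTheory.PAdicHodge.fontainePstAdicCompletion v₁ ℓ hv₁).𝔅 τ₁.toRingHom)) → ¬ (∀ (v : IsDedekindDomain.HeightOneSpectrum (NumberField.RingOfIntegers K)) (hv : ((ℓ : ℕ) : NumberField.RingOfIntegers K) ∈ v.asIdeal), letI := (Literature.NumberTheory.PAdicHodge.fontainePstAdicCompletion v ℓ hv).algebra; ∀ τ : v.adicCompletion K →ₐ[ℚ_[ℓ]] PadicAlgCl ℓ, (ρ.labelledHodgeTateWeightsAt v (Literature.NumberTheory.PAdicHodge.fontainePstAdicCompletion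 v ℓ hv).algebra (Literature.NumberTheory.PAdicHodge.fontainePstAdicCompletion v ℓ hv).𝔅 τ.toRingHom).Nodup) → ((∀ᶠ v : IsDedekindDomain.HeightOneSpectrum (NumberField.RingOfIntegers K) in cofinite, ρ.IsUnramifiedAt v) ∧ ∀ (v : IsDedekindDomain.HeightOneSpectrum (NumberField.RingOfIntegers K)) (hv : ((ℓ : ℕ) : NumberField.RingOfIntegers K) ∈ v.asIdeal), (Literature.NumberTheory.PAdicHodge.fontainePstAdicCompletion v ℓ hv).IsDeRhamFramed (ρ.toLocal v)) → ∃ π : Literature.NumberTheory.Automorphic.CuspidalAutomorphicRepData n K hcpt, π.1.IsLAlgebraic ∧ ∀ᶠ v : IsDedekindDomain.HeightOneSpectrum (NumberField.RingOfIntegers K) in cofinite, SatakeFrobCompatibleAt ι π.1 ρ v) :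
    ImpureWeightAutomorphy := by
  intro K _ _ n hcpt hn ℓ _ ι ρ hirr hD hgeo
  by_cases hreg : (∀ (v : IsDedekindDomain.HeightOneSpectrum (NumberField.RingOfIntegers K)) (hv : ((ℓ : ℕ) : NumberField.RingOfIntegers K) ∈ v.asIdeal), letI := (Literature.NumberTheory.PAdicHodge.fontainePstAdicCompletion v ℓ hv).algebra; ∀ τ : v.adicCompletion K →ₐ[ℚ_[ℓ]] PadicAlgCl ℓ, (ρ.labelledHodgeTateWeightsAt v (Literature.NumberTheory.PAdicHodge.fontainePstAdicCompletion v ℓ hv).algebra (Literature.NumberTheory.PAdicHodge.fontainePstAdicCompletion v ℓ hv).𝔅 τ.toRingHom).Nodup)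
  · exact hR K n hcpt hn ℓ ι ρ hirr hD hreg hgeo
  · exact hIR K n hcpt hn ℓ ι ρ hirr hD hreg hgeo

/-- The skeleton concludes the cell BY NAME from the registered stubs. -/
theorem ImpureWeightAutomorphy_of_stubs : ImpureWeightAutomorphy := ImpureWeightAutomorphy_of stub_impureRegular stub_impureIrregular

/-- BC5 rung text: IMPB ∣ n = 1. -/
def ImpureRankOneRung : Prop :=
  ∀ (K : Type) [Field K] [NumberField K] (hcpt : Literature.NumberTheory.Automorphic.isCompact_glFiniteIntegralLevel 1 K), ∀ (ℓ : ℕ) [Fact ℓ.Prime] (ι : PadicAlgCl ℓ ≃+* ℂ) (ρ : Literature.NumberTheory.GaloisRepresentations.FramedGaloisRep K (PadicAlgCl ℓ) 1), ρ.toGaloisRep.IsIrreducible → ¬ (∃ w : ℤ, ∀ (v₁ : IsDedekindDomain.HeightOneSpectrum (NumberField.RingOfIntegers K)) (hv₁ : ((ℓ : ℕ) : NumberField.RingOfIntegers K) ∈ v₁.asIdeal) (v₂ : IsDedekindDomain.HeightOneSpectrum (NumberField.RingOfIntegers K)) (hv₂ : ((ℓ : ℕ) : NumberField.RingOfIntegers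 K) ∈ v₂.asIdeal), letI := (Literature.NumberTheory.PAdicHodge.fontainePstAdicCompletion v₁ ℓ hv₁).algebra; letI := (Literature.NumberTheory.PAdicHodge.fontainePstAdicCompletion v₂ ℓ hv₂).algebra; ∀ (τ₁ : v₁.adicCompletion K →ₐ[ℚ_[ℓ]] PadicAlgCl ℓ) (τ₂ : v₂.adicCompletion K →ₐ[ℚ_[ℓ]] PadicAlgCl ℓ), (∀ x : K, ι (τ₂ (algebraMap K (v₂.adicCompletion K) x)) = starRingEnd ℂ (ι (τ₁ (algebraMap K (v₁.adicCompletion K) x)))) → ρ.labelledHodgeTateWeightsAt v₂ (Literature.NumberTheory.PAdicHodge.fontainePstAdicCompletion v₂ ℓ hv₂).algebra (Literature.NumberTheory.PAdicHodge.fontainePstAdicCompletion v₂ ℓ hv₂).𝔅 τ₂.toRingHom = Multiset.map (fun k : ℤ => w - k) (ρ.labelledHodgeTateWeightsAt v₁ (Literature.NumberTheory.PAdicHodge.fontainePstAdicCompletion v₁ ℓ hv₁).algebra (Literature.NumberTheory.PAdicHodge.fontainePstAdicCompletion v₁ ℓ hv₁).𝔅 τ₁.toRingHom)) → ((∀ᶠ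 v : IsDedekindDomain.HeightOneSpectrum (NumberField.RingOfIntegers K) in cofinite, ρ.IsUnramifiedAt v) ∧ ∀ (v : IsDedekindDomain.HeightOneSpectrum (NumberField.RingOfIntegers K)) (hv : ((ℓ : ℕ) : NumberField.RingOfIntegers K) ∈ v.asIdeal), (Literature.NumberTheory.PAdicHodge.fontainePstAdicCompletion v ℓ hv).IsDeRhamFramed (ρ.toLocal v)) → ∃ π : Literature.NumberTheory.Automorphic.CuspidalAutomorphicRepData 1 K hcpt, π.1.IsLAlgebraic ∧ ∀ᶠ v : IsDedekindDomain.HeightOneSpectrum (NumberField.RingOfIntegers K) in cofinite, SatakeFrobCompatibleAt ι π.1 ρ v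

/-- **BC5 rung (plan-only, PRINT)** — BC5 rung (PLAN-ONLY, PRINT): IMPB ∣ n = 1 — vacuously true in print: geometric characters are algebraic Hecke characters, whose labelled weights n_σ satisfy n_σ + n_{cσ} = w (Weil), i.e. they are ι-pure for every ι; `rung_of_cell : IMPB → rung`. -/
theorem stub_rung_impureRankOne : ImpureRankOneRung := by
  sorry

/-- the rung IS the `n = 1` restriction of the cell. -/
theorem rung_of_cell (h : ImpureWeightAutomorphy) : ImpureRankOneRung :=
  fun K _ _ hcpt ℓ _ ι ρ hirr hD hgeo => h K 1 hcpt one_pos ℓ ι ρ hirr hD hgeo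

/-- identity with the born route decl (elaborates only AFTER birth). -/
theorem ImpureWeightAutomorphy_iff_route : ImpureWeightAutomorphy ↔ Summit.Langlands.Langlands.Theses.HodgeTatePurityCarving.ImpureWeightAutomorphy := Iff.rfl

/-- the ROUTE decl from the stubs. -/
theorem route_ImpureWeightAutomorphy_of_stubs : Summit.Langlands.Langlands.Theses.HodgeTatePurityCarving.ImpureWeightAutomorphy := ImpureWeightAutomorphy_iff_route.1 ImpureWeightAutomorphy_of_stubs

end Summit.Langlands.Langlands.Theses.HodgeTatePurityCarving.Birth.ImpureWeightAutomorphy
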